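import Summits.QuantumFields.BalabanUV.T4Continuum.Spine.NE3.FlatLandauNewtonScheme
import HarnessLib

/-!
# T⁴ programme, node NE3 — [B8] AT THE FLAT BACKGROUND, brick E, letter 4b = THE END OF BRICK E: THE EXACT (1.38)-LANDAU REPRESENTATIVE
# AT `W = 1` EXISTS — `∃ u` unitary periodic, `Z` skew periodic with `U^{u} = vary 1 Z 1`, `IsLandauB8 L N (j+1) flatCfg Z`,
# `‖U^{u} − 1‖ ≤ r₀ + (5∕2)c₁c_R·M·b₀`, `‖u − 1‖ ≤ 4c₀c_R·M²·b₀` — from `‖U − 1‖ ≤ r₀`, `‖covDiv 1 log U‖_∞ ≤ b₀` and ONE smallness line;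
# with the tree's flat letters plugged: `c₀ = 16d³`, `c₁ = 16d²`, `c_R = 1 + card n + 64^{2d+1}d⁴(card n)²N^{d+2}` (`FlatLandauRep`)

Cell `pub-balaban`, rung (B)+1 sub-cell t4, row NE3 (OWNER lineage `b2b-balaban-t4-ne3-p1`, generation 27; technique of record:
implicit-function ∕ contraction mapping).  Last file of the chain «BRICK E OF REP♭ AT FLAT PAIRS» = the EXACT nonlinear (1.38)-Landau step of
[Balaban1985RegularSpaces] («B8») Sect. E, Prop. 5 pp. 89–94 (the fixed point (1.100)), AT THE FLAT BACKGROUND `U₀ = 1` on the T⁴ programme's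
lattice — asked of «row NE3's owner» by the CRUX prover NE7 (HOME/INBOX [NE7P1-G72-INBOX-4] «your `LandauRepB8` at FLAT pairs (1, U) is now NE7's last
Bałaban hypothesis at the trivial datum»; crux card `t4/b2b-balaban-t4-ne7-p1-g72/REP-FLAT-CRUX-CARD.md` N3; road
`t4/b2b-balaban-t4-ne7-p1-g73/REP-FLAT-ROAD-v2.md` §3∕§4 brick **E** «the exact top step: Prop 5 at flat as a fixed point in N(Q′) with the sup-max
norm»), over letters 1 `FlatLandauExpStar`, 2a `FlatLandauGaugeBond`, 2b `FlatLandauGaugeStep`, 3 `FlatLandauNewtonStep`, 4a `FlatLandauNewtonScheme`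
and row NE3's flat Landau theory (`LandauProjectionB8`, `LandauCorrectionSupB8Flat[H0]`, `LandauProjectionSupFlat`; pub-balaban-gaps seat ne3).

THE THEOREM (`exists_flatLandauRep_of_supFacts`; every `d ≥ 1`, `L ≥ 2`, `N ≥ 1`, level `j+1`, `M = L^{j+1}`, period `P = N·M`; flat sup letters (H0),
(HR) as hypotheses with `0 ≤ c₀, c₁`, `1 ≤ c_R`).  For a unitary `P`-periodic `U` with `‖U(b) − 1‖ ≤ r₀` and `‖covDiv 1 (log U)(x)‖ ≤ b₀`, in the
regime `c₀M²c_Rb₀ ≤ 1∕10`, `c₁Mc_Rb₀ ≤ 1∕25`, `r̄ := r₀ + (5∕2)c₁Mc_Rb₀ ≤ 1∕20` and under THE LINE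
`c_R·(4c₀M²(b₀ + 4c_Rb₀) + 25·d·r̄·(c₁M) + 14·d·(c₁M)²·c_Rb₀) ≤ 1∕2`, there are a unitary `P`-periodic site gauge `u` and a skew `P`-periodic
direction `Z` with `U^{u} = vary flatCfg Z 1`, **`IsLandauB8 L N (j+1) flatCfg Z`** ([Balaban1985RegularSpaces] (1.38) relative to `N(Q′(1))`, EXACTLY),
`‖U^{u}(b) − 1‖ ≤ r̄`, `‖Z(b)‖ ≤ 2r̄`, `‖u − 1‖ ≤ 4c₀M²c_Rb₀`, `‖covDiv 1 Z‖_∞ ≤ b₀ + 3c_Rb₀`.  `exists_flatLandauRep` plugs the tree's PROVED flat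
letters (`supRegularity_flatCfg`: `c₀ = 16d³`, `c₁ = 16d²`; `covLapSite_sup_le_flatCfg`: `c_R = 1 + card n + 64^{2d+1}d⁴(card n)²N^{d+2}`).
READING FOR REP♭ (road v2 §3): with `r₀ = B₁δ∕M` and a (−2)-size divergence datum `b₀ = δ′∕M²`, every line is `O(δ + δ′)` uniformly in `M` (at
fixed `N`; the `N`-dependence sits in the tree's `c_R` only and an `N`-uniform (HR) plugs into `exists_flatLandauRep_of_supFacts` unchanged) and
the output is the (1.38)-Landau representative with `‖Z‖ ≤ 2(B₁δ + 40d²c_Rδ′)∕M` — the `landau`, `sup`, `rep`, `unitary`, `periodic`, `skew`, `per`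
members of `PairLandauB8.LandauRepB8 L N (j+1) flatCfg U u Z …`; the `grad`∕`holder`∕`lap` members ((1.36) second clause, Hölder, (1.39)) are NOT
produced here (they need the gradient currency of the input — NE7's (156)–(159) ∕ [Balaban1985RegularSpaces] Lemmas 3–4).  LOCATED REQUIREMENT
(recorded, not a defect of anything in print): a sup-only datum `‖log U‖ ≤ a` gives `b₀ ≤ 2d·a` and the line then reads `M²·a = O(1)` — NOT `M·a`;
the exact step is k-uniform only behind a divergence datum of (−2) size, as in Bałaban's inductive (1.36).

METHOD (letters 4a → here): the Newton sequence `u_i` of `FlatLandauNewtonScheme.exists_newton_sequence` is pointwise Cauchy (`‖u_{i+1} − u_i‖ ≤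
2c₀M²c_Rb₀·2^{−i}`); its pointwise limit `u` is unitary (`isClosed_unitary`) and periodic; the bond variables `U^{u_i}(b) → U^{u}(b)`, so the radius
bound passes to the limit, `log` is `4∕3`-Lipschitz there (`NE7ExpLogSecondOrder.norm_mlog_sub_mlog_le_four_thirds`), hence `Z_i → Z := log U^{u}`
bondwise and the divergence bound passes to the limit; finally, for each test generator `ν ∈ N(Q′(1))` the pairing `Σ hsR (Z_i)(D_1Δ_1ν)` equals
`−Σ hsR (Δ_1λ_i)(Δ_1ν)` (Landau pair `(Z_i, λ_i)` + `LandauProjectionB8.sum_hsR_gaugeDir_gaugeDir_covLapSite`), which is `O(2^{−i})`, and tends to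
the pairing of `Z` — so `Z` is (1.38)-Landau EXACTLY.

HONEST FRAMING (page 1): an elementary fixed-point theorem about OUR lattice objects at the FLAT background; the flat (H0)∕(HR) letters it consumes
are PROVED tree theorems (the latter with a constant polynomial in `N`); nothing of Bałaban's is asserted or discharged — [B8] Prop. 5 ∕ Thm 2 are
about curved regular backgrounds with the full (1.36)∕(1.39) regularity ladder, of which this is the flat, sup-member-only case; REP♭ (NE7's
hypothesis) is NOT proved here (its input `b₀` of (−2) size and its gradient member remain NE7's road v2 §2–§3); `PairLandauGaugeB8` ∕ NE3 ∕ NE7 NOT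
proved; spine PROVED 0∕9; finite T⁴ rung (B)+1 — NOT infinite volume, NOT mass gap, NOT `BetaPertH`, NOT Clay.  Continuum YM on T⁴ ⇐ BetaPertH ∧ nine
spine estimates (0/9 proved); BetaPertH ⇐ (D1) ∧ (D4) ∧ CAP+tail; G-an2-4 gates asym, D1 and NE2/3/4.  PLACEMENT: our theorem, `Spine/NE3/`.
-/

set_option autoImplicit false

open NormedSpace Filter Topology
open scoped BigOperators Matrix.Norms.L2Operator
open Finset

namespace Summit.QuantumFields.BalabanUV.T4Continuum.NE3.FlatLandauRep

open Literature.MathematicalPhysics.QuantumFieldTheory.Balaban1983to89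
open B7Prop1Explicit B7Prop2Explicit MatrixLog
open T4AveragingDeficitWall (Ad IsUnitaryCfg IsSkewDir vary)
open T4AveragingDeficitWallBoundary (IsPeriodicCfg periodBox)
open AveragingDeficitPeriodicCounting (IsPeriodicDir)
open MinimalActionWitness (flatCfg isPeriodicCfg_flatCfg)
open NE3FlatHessianCurl (isUnitaryCfg_flatCfg)
open NE3EnergyShapes (IsUnitarySite IsPeriodicSite)
open NE3CovariantWeitzenbock (covDiv covDiv_flatCfg)
open NE3CovariantCalculus (hsR hsR_add_left hsR_sub_left abs_hsR_le)
open BlockAveragePushDirGauge (gaugeDir)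
open NE3.PairLandauB8 (avgKernelGauges IsLandauB8 covLapSite)
open NE3.LandauProjectionB8 (sum_hsR_gaugeDir_gaugeDir_covLapSite)
open NE3.LandauCorrectionSupB8FlatH0 (supRegularity_flatCfg)
open NE3.LandauProjectionSupFlat (covLapSite_sup_le_flatCfg)
open NE7ExpLogSecondOrder (norm_mlog_sub_mlog_le_four_thirds)
open NE3.FlatLandauNewtonStep (isPeriodicDir_mlog_cfg isSkewDir_mlog_cfg)
open NE3.FlatLandauNewtonScheme (exists_newton_sequence)

noncomputable section

variable {d : ℕ} {n : Type*} [Fintype n] [DecidableEq n]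

/-- **THE EXACT (1.38)-LANDAU REPRESENTATIVE AT THE FLAT BACKGROUND — LETTER FORM** (statement in the module docstring; the flat sup letters (H0) `hG`,
(HR) `hR` as hypotheses with constants `0 ≤ c₀, c₁`, `1 ≤ c_R`, in the binder shape of
`LandauCorrectionSupB8Flat.landauCorrectionSupB8_flatCfg_of_supFacts`).  [Balaban1985RegularSpaces] Sect. E Prop. 5 TYPE at `U₀ = 1`, sup member;
PROVED here by the Newton scheme of letters 1–4a and a pointwise limit. [folklore] -/
theorem exists_flatLandauRep_of_supFacts [Nonempty n] (hd : 1 ≤ d) {L N : ℕ} (hL : 2 ≤ L) (hN : 1 ≤ N) (j : ℕ) {c₀ c₁ cR : ℝ}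
    (hc₀ : 0 ≤ c₀) (hc₁ : 0 ≤ c₁) (hcR : 1 ≤ cR)
    (hG : ∀ mu ∈ avgKernelGauges (d := d) (n := n) L N (j + 1) (flatCfg (d := d) (n := n)), ∀ B : ℝ,
      (∀ y : Site d, ‖covLapSite (flatCfg (d := d) (n := n)) mu y‖ ≤ B) →
        (∀ y : Site d, ‖mu y‖ ≤ c₀ * ((L : ℝ) ^ (j + 1)) ^ 2 * B) ∧
        (∀ (y : Site d) (μ : Fin d), ‖gaugeDir (flatCfg (d := d) (n := n)) mu y μ‖ ≤ c₁ * (L : ℝ) ^ (j + 1) * B))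
    (hR : ∀ (F : Site d → (Matrix n n ℂ)), (∀ y : Site d, F y ∈ skewAdjoint (Matrix n n ℂ)) →
      (∀ (y : Site d) (i : Fin d), F (y + ((N * L ^ (j + 1) : ℕ) : ℤ) • e i) = F y) →
      ∀ mu ∈ avgKernelGauges (d := d) (n := n) L N (j + 1) (flatCfg (d := d) (n := n)),
        (∀ nu ∈ avgKernelGauges (d := d) (n := n) L N (j + 1) (flatCfg (d := d) (n := n)),
          ∑ y ∈ periodBox (d := d) (N * L ^ (j + 1)),
            hsR (F y + covLapSite (flatCfg (d := d) (n := n)) mu y) (covLapSite (flatCfg (d := d) (n := n)) nu y) = 0) →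
        ∀ B : ℝ, (∀ y : Site d, ‖F y‖ ≤ B) → ∀ y : Site d, ‖covLapSite (flatCfg (d := d) (n := n)) mu y‖ ≤ cR * B)
    {U : Site d → Fin d → (Matrix n n ℂ)ˣ} (hUu : IsUnitaryCfg U) (hUP : IsPeriodicCfg U ((N * L ^ (j + 1) : ℕ) : ℤ))
    {r₀ b₀ : ℝ} (hr₀ : ∀ (y : Site d) (μ : Fin d), ‖((U y μ : (Matrix n n ℂ)ˣ) : (Matrix n n ℂ)) - 1‖ ≤ r₀)
    (hb₀ : ∀ x : Site d, ‖covDiv (flatCfg (d := d) (n := n)) (fun y μ => mlog ((U y μ : (Matrix n n ℂ)ˣ) : (Matrix n n ℂ))) x‖ ≤ b₀)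
    (hreg₁ : c₀ * ((L : ℝ) ^ (j + 1)) ^ 2 * (cR * b₀) ≤ 1 / 10) (hreg₂ : c₁ * (L : ℝ) ^ (j + 1) * (cR * b₀) ≤ 1 / 25)
    (hreg₃ : r₀ + 5 / 2 * (c₁ * (L : ℝ) ^ (j + 1) * (cR * b₀)) ≤ 1 / 20)
    (hline : cR * (4 * (c₀ * ((L : ℝ) ^ (j + 1)) ^ 2) * (b₀ + 4 * (cR * b₀))
        + 25 * d * (r₀ + 5 / 2 * (c₁ * (L : ℝ) ^ (j + 1) * (cR * b₀))) * (c₁ * (L : ℝ) ^ (j + 1))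
        + 14 * d * (c₁ * (L : ℝ) ^ (j + 1)) ^ 2 * (cR * b₀)) ≤ 1 / 2) :
    ∃ (u : Site d → (Matrix n n ℂ)ˣ) (Z : Site d → Fin d → (Matrix n n ℂ)),
      IsUnitarySite u ∧ IsPeriodicSite u ((N * L ^ (j + 1) : ℕ) : ℤ) ∧ IsSkewDir Z ∧ IsPeriodicDir Z ((N * L ^ (j + 1) : ℕ) : ℤ) ∧
      gaugeAct u U = vary (flatCfg (d := d) (n := n)) Z 1 ∧ IsLandauB8 (d := d) L N (j + 1) (flatCfg (d := d) (n := n)) Z ∧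
      (∀ (y : Site d) (μ : Fin d), ‖((gaugeAct u U y μ : (Matrix n n ℂ)ˣ) : (Matrix n n ℂ)) - 1‖ ≤ r₀ + 5 / 2 * (c₁ * (L : ℝ) ^ (j + 1) * (cR * b₀))) ∧
      (∀ (y : Site d) (μ : Fin d), ‖Z y μ‖ ≤ 2 * (r₀ + 5 / 2 * (c₁ * (L : ℝ) ^ (j + 1) * (cR * b₀)))) ∧
      (∀ y : Site d, ‖((u y : (Matrix n n ℂ)ˣ) : (Matrix n n ℂ)) - 1‖ ≤ 4 * (c₀ * ((L : ℝ) ^ (j + 1)) ^ 2 * (cR * b₀))) ∧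
      (∀ x : Site d, ‖covDiv (flatCfg (d := d) (n := n)) Z x‖ ≤ b₀ + 3 * (cR * b₀)) := by
  letI : NormedAlgebra ℚ (Matrix n n ℂ) := NormedAlgebra.restrictScalars ℚ ℝ (Matrix n n ℂ)
  letI : CStarAlgebra (Matrix n n ℂ) := {}
  have hP : 1 ≤ N * L ^ (j + 1) := Nat.mul_pos (by omega) (Nat.pow_pos (by omega))
  obtain ⟨useq, hseq⟩ := exists_newton_sequence hd hL hN j hc₀ hc₁ hcR hG hR hUu hUP hr₀ hb₀ hreg₁ hreg₂ hreg₃ hline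
  set M : ℝ := (L : ℝ) ^ (j + 1) with hM
  set rbar : ℝ := r₀ + 5 / 2 * (c₁ * M * (cR * b₀)) with hrbar
  have hrbar4 : rbar ≤ 1 / 4 := hreg₃.trans (by norm_num)
  -- pointwise limits of the gauges
  have hcau : ∀ y : Site d, CauchySeq fun i => ((useq i y : (Matrix n n ℂ)ˣ) : (Matrix n n ℂ)) := fun y =>
    cauchySeq_of_le_geometric (1 / 2) (2 * (c₀ * M ^ 2 * (cR * b₀))) (by norm_num) fun i => by
      rw [dist_eq_norm, norm_sub_rev]; exact (hseq i).2.2.2.2.1 y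
  choose ulim hul using fun y => cauchySeq_tendsto_of_complete (hcau y)
  have hmem : ∀ y : Site d, ulim y ∈ unitary (Matrix n n ℂ) := fun y =>
    isClosed_unitary.mem_of_tendsto (hul y) (Eventually.of_forall fun i => mem_unitaryUnits.mp ((hseq i).1 y))
  let ulimU : Site d → (Matrix n n ℂ)ˣ := fun y => Unitary.toUnits ⟨ulim y, hmem y⟩
  have hval : ∀ y : Site d, ((ulimU y : (Matrix n n ℂ)ˣ) : (Matrix n n ℂ)) = ulim y := fun y => rfl
  have huU : IsUnitarySite ulimU := fun y => mem_unitaryUnits.mpr (by rw [hval]; exact hmem y)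
  have huP : IsPeriodicSite ulimU ((N * L ^ (j + 1) : ℕ) : ℤ) := by
    intro y i
    have hfun : (fun k => ((useq k (y + ((N * L ^ (j + 1) : ℕ) : ℤ) • e i) : (Matrix n n ℂ)ˣ) : (Matrix n n ℂ))) = fun k => ((useq k y : (Matrix n n ℂ)ˣ) : (Matrix n n ℂ)) := by
      funext k; rw [(hseq k).2.1 y i]
    have h1 := hul (y + ((N * L ^ (j + 1) : ℕ) : ℤ) • e i)
    rw [hfun] at h1
    exact Units.ext (by rw [hval, hval]; exact tendsto_nhds_unique h1 (hul y))
  -- convergence of the bond variables and the radius in the limit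
  have hV : ∀ (y : Site d) (μ : Fin d),
      Tendsto (fun i => ((gaugeAct (useq i) U y μ : (Matrix n n ℂ)ˣ) : (Matrix n n ℂ))) atTop (𝓝 ((gaugeAct ulimU U y μ : (Matrix n n ℂ)ˣ) : (Matrix n n ℂ))) := by
    intro y μ
    have hform : ∀ (v : Site d → (Matrix n n ℂ)ˣ), IsUnitarySite v →
        ((gaugeAct v U y μ : (Matrix n n ℂ)ˣ) : (Matrix n n ℂ)) = (v y : (Matrix n n ℂ)) * (U y μ : (Matrix n n ℂ)) * star ((v (y + e μ) : (Matrix n n ℂ)ˣ) : (Matrix n n ℂ)) := fun v hv => by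
      simp only [gaugeAct, Units.val_mul,
        Units.inv_eq_of_mul_eq_one_right (Unitary.mul_star_self_of_mem (mem_unitaryUnits.mp (hv (y + e μ))))]
    rw [hform ulimU huU]
    simp only [hform (useq _) ((hseq _).1), hval]
    exact ((hul y).mul tendsto_const_nhds).mul (hul (y + e μ)).star
  have hr : ∀ (y : Site d) (μ : Fin d), ‖((gaugeAct ulimU U y μ : (Matrix n n ℂ)ˣ) : (Matrix n n ℂ)) - 1‖ ≤ rbar := fun y μ =>
    le_of_tendsto ((hV y μ).sub_const 1).norm (Eventually.of_forall fun i => (hseq i).2.2.1 y μ)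
  -- the limiting potential
  set Z : Site d → Fin d → (Matrix n n ℂ) := fun y μ => mlog ((gaugeAct ulimU U y μ : (Matrix n n ℂ)ˣ) : (Matrix n n ℂ)) with hZ_def
  have hVu : IsUnitaryCfg (gaugeAct ulimU U) := AveragingDeficitKDatum.isUnitaryCfg_gaugeAct huU hUu
  have hZs : IsSkewDir Z := isSkewDir_mlog_cfg hVu fun y μ => (hr y μ).trans hrbar4
  have hZP : IsPeriodicDir Z ((N * L ^ (j + 1) : ℕ) : ℤ) := isPeriodicDir_mlog_cfg (NE3ResidualSliceRep.isPeriodicCfg_gaugeAct huP hUP)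
  have hrep : gaugeAct ulimU U = vary (flatCfg (d := d) (n := n)) Z 1 := by
    funext y μ
    refine Units.ext ?_
    have h1 : ‖((gaugeAct ulimU U y μ : (Matrix n n ℂ)ˣ) : (Matrix n n ℂ)) - 1‖ < 1 := (hr y μ).trans_lt (by linarith)
    simp only [vary, flatCfg, one_mul, val_expUnit, Complex.ofReal_one, one_smul]
    exact (exp_mlog h1).symm
  have hZlim : ∀ (y : Site d) (μ : Fin d), Tendsto (fun i => mlog ((gaugeAct (useq i) U y μ : (Matrix n n ℂ)ˣ) : (Matrix n n ℂ))) atTop (𝓝 (Z y μ)) := by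
    intro y μ
    rw [tendsto_iff_norm_sub_tendsto_zero]
    have h0 : Tendsto (fun i => 4 / 3 * ‖((gaugeAct (useq i) U y μ : (Matrix n n ℂ)ˣ) : (Matrix n n ℂ)) - gaugeAct ulimU U y μ‖) atTop (𝓝 0) := by
      have := (tendsto_iff_norm_sub_tendsto_zero.mp (hV y μ)).const_mul (4 / 3)
      simpa using this
    exact squeeze_zero (fun _ => norm_nonneg _)
      (fun i => norm_mlog_sub_mlog_le_four_thirds hrbar4 ((hseq i).2.2.1 y μ) (hr y μ)) h0
  have hcd : ∀ x : Site d, ‖covDiv (flatCfg (d := d) (n := n)) Z x‖ ≤ b₀ + 3 * (cR * b₀) := by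
    intro x
    have ht : Tendsto (fun i => covDiv (flatCfg (d := d) (n := n)) (fun y μ => mlog ((gaugeAct (useq i) U y μ : (Matrix n n ℂ)ˣ) : (Matrix n n ℂ))) x) atTop
        (𝓝 (covDiv (flatCfg (d := d) (n := n)) Z x)) := by
      simp only [covDiv_flatCfg]
      exact tendsto_finsetSum _ fun μ _ => (hZlim x μ).sub (hZlim (x - e μ) μ)
    exact le_of_tendsto ht.norm (Eventually.of_forall fun i => (hseq i).2.2.2.1 x)
  -- (1.38) in the limit
  have hLan : IsLandauB8 (d := d) L N (j + 1) (flatCfg (d := d) (n := n)) Z := by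
    intro nu hnu
    have hnuP : ∀ (y : Site d) (i : Fin d), nu (y + ((N * L ^ (j + 1) : ℕ) : ℤ) • e i) = nu y := hnu.2.1
    set g : Site d → Fin d → (Matrix n n ℂ) := gaugeDir (flatCfg (d := d) (n := n)) (covLapSite (flatCfg (d := d) (n := n)) nu) with hg
    -- the pairing of the iterates tends to the pairing of the limit
    have hpair : ∀ (x : Site d) (κ : Fin d),
        Tendsto (fun i => hsR (mlog ((gaugeAct (useq i) U x κ : (Matrix n n ℂ)ˣ) : (Matrix n n ℂ))) (g x κ)) atTop (𝓝 (hsR (Z x κ) (g x κ))) := by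
      intro x κ
      rw [tendsto_iff_norm_sub_tendsto_zero]
      have h0 : Tendsto (fun i => ‖mlog ((gaugeAct (useq i) U x κ : (Matrix n n ℂ)ˣ) : (Matrix n n ℂ)) - Z x κ‖ * ‖g x κ‖) atTop (𝓝 0) := by
        have := (tendsto_iff_norm_sub_tendsto_zero.mp (hZlim x κ)).mul_const ‖g x κ‖
        simpa using this
      refine squeeze_zero (fun _ => norm_nonneg _) (fun i => ?_) h0
      rw [Real.norm_eq_abs, ← hsR_sub_left]
      exact abs_hsR_le _ _
    have hlim : Tendsto (fun i => ∑ x ∈ periodBox (d := d) (N * L ^ (j + 1)), ∑ κ : Fin d,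
        hsR (mlog ((gaugeAct (useq i) U x κ : (Matrix n n ℂ)ˣ) : (Matrix n n ℂ))) (g x κ)) atTop
        (𝓝 (∑ x ∈ periodBox (d := d) (N * L ^ (j + 1)), ∑ κ : Fin d, hsR (Z x κ) (g x κ))) :=
      tendsto_finsetSum _ fun x _ => tendsto_finsetSum _ fun κ _ => hpair x κ
    -- the pairing of the iterates is `O(2^{−i})`
    set C : ℝ := ∑ x ∈ periodBox (d := d) (N * L ^ (j + 1)), ‖covLapSite (flatCfg (d := d) (n := n)) nu x‖ with hC
    have hsmall : ∀ i : ℕ, |∑ x ∈ periodBox (d := d) (N * L ^ (j + 1)), ∑ κ : Fin d,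
        hsR (mlog ((gaugeAct (useq i) U x κ : (Matrix n n ℂ)ˣ) : (Matrix n n ℂ))) (g x κ)| ≤ (cR * b₀) * (1 / 2) ^ i * C := by
      intro i
      obtain ⟨lam, hlam, hLan_i, hD_i⟩ := (hseq i).2.2.2.2.2.2
      have hlamP : ∀ (y : Site d) (k : Fin d), lam (y + ((N * L ^ (j + 1) : ℕ) : ℤ) • e k) = lam y := hlam.2.1
      have h0 := hLan_i nu hnu
      have hsplit : ∑ x ∈ periodBox (d := d) (N * L ^ (j + 1)), ∑ κ : Fin d, hsR (mlog ((gaugeAct (useq i) U x κ : (Matrix n n ℂ)ˣ) : (Matrix n n ℂ))) (g x κ)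
          = -∑ x ∈ periodBox (d := d) (N * L ^ (j + 1)),
              hsR (covLapSite (flatCfg (d := d) (n := n)) lam x) (covLapSite (flatCfg (d := d) (n := n)) nu x) := by
        rw [← sum_hsR_gaugeDir_gaugeDir_covLapSite hP isUnitaryCfg_flatCfg (isPeriodicCfg_flatCfg _) hlamP hnuP]
        simp only [hsR_add_left, Finset.sum_add_distrib] at h0
        rw [hg]
        linarith
      rw [hsplit, abs_neg]
      calc |∑ x ∈ periodBox (d := d) (N * L ^ (j + 1)),
              hsR (covLapSite (flatCfg (d := d) (n := n)) lam x) (covLapSite (flatCfg (d := d) (n := n)) nu x)|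
          ≤ ∑ x ∈ periodBox (d := d) (N * L ^ (j + 1)),
              |hsR (covLapSite (flatCfg (d := d) (n := n)) lam x) (covLapSite (flatCfg (d := d) (n := n)) nu x)| :=
            Finset.abs_sum_le_sum_abs _ _
        _ ≤ ∑ x ∈ periodBox (d := d) (N * L ^ (j + 1)),
              (cR * b₀) * (1 / 2) ^ i * ‖covLapSite (flatCfg (d := d) (n := n)) nu x‖ :=
            Finset.sum_le_sum fun x _ => (abs_hsR_le _ _).trans (mul_le_mul_of_nonneg_right (hD_i x) (norm_nonneg _))
        _ = (cR * b₀) * (1 / 2) ^ i * C := by rw [hC, Finset.mul_sum]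
    have hzero : Tendsto (fun i => ∑ x ∈ periodBox (d := d) (N * L ^ (j + 1)), ∑ κ : Fin d,
        hsR (mlog ((gaugeAct (useq i) U x κ : (Matrix n n ℂ)ˣ) : (Matrix n n ℂ))) (g x κ)) atTop (𝓝 0) := by
      have hgeom : Tendsto (fun i : ℕ => (cR * b₀) * (1 / 2 : ℝ) ^ i * C) atTop (𝓝 0) := by
        have := ((tendsto_pow_atTop_nhds_zero_of_lt_one (by norm_num : (0 : ℝ) ≤ 1 / 2) (by norm_num)).const_mul (cR * b₀)).mul_const C
        simpa using this
      exact squeeze_zero_norm (fun i => by rw [Real.norm_eq_abs]; exact hsmall i) hgeom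
    exact tendsto_nhds_unique hlim hzero
  refine ⟨ulimU, Z, huU, huP, hZs, hZP, hrep, hLan, hr, fun y μ => ?_, fun y => ?_, hcd⟩
  · exact (norm_mlog_le_two_mul ((hr y μ).trans (by linarith))).trans (by linarith [hr y μ])
  · exact le_of_tendsto ((hul y).sub_const 1).norm (Eventually.of_forall fun i => (hseq i).2.2.2.2.2.1 y)

/-- **THE EXACT (1.38)-LANDAU REPRESENTATIVE AT THE FLAT BACKGROUND** with the tree's PROVED flat letters plugged: (H0)
`LandauCorrectionSupB8FlatH0.supRegularity_flatCfg` (`c₀ = 16d³`, `c₁ = 16d²`, lattice maximum principle) and (HR)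
`LandauProjectionSupFlat.covLapSite_sup_le_flatCfg` (`c_R = 1 + card n + 64^{2d+1}d⁴(card n)²N^{d+2}`).  Every `d ≥ 1`, `L ≥ 2`, `N ≥ 1`, `j`; the four
numeric lines are those of `exists_flatLandauRep_of_supFacts` with these constants. [folklore] -/
theorem exists_flatLandauRep [Nonempty n] (hd : 1 ≤ d) {L N : ℕ} (hL : 2 ≤ L) (hN : 1 ≤ N) (j : ℕ)
    {U : Site d → Fin d → (Matrix n n ℂ)ˣ} (hUu : IsUnitaryCfg U) (hUP : IsPeriodicCfg U ((N * L ^ (j + 1) : ℕ) : ℤ))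
    {r₀ b₀ : ℝ} (hr₀ : ∀ (y : Site d) (μ : Fin d), ‖((U y μ : (Matrix n n ℂ)ˣ) : (Matrix n n ℂ)) - 1‖ ≤ r₀)
    (hb₀ : ∀ x : Site d, ‖covDiv (flatCfg (d := d) (n := n)) (fun y μ => mlog ((U y μ : (Matrix n n ℂ)ˣ) : (Matrix n n ℂ))) x‖ ≤ b₀)
    (hreg₁ : (16 * (d : ℝ) ^ 3) * ((L : ℝ) ^ (j + 1)) ^ 2
      * ((1 + (Fintype.card n : ℝ) + (64 : ℝ) ^ (2 * d + 1) * (d : ℝ) ^ 4 * (Fintype.card n : ℝ) ^ 2 * (N : ℝ) ^ (d + 2)) * b₀) ≤ 1 / 10)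
    (hreg₂ : (16 * (d : ℝ) ^ 2) * (L : ℝ) ^ (j + 1)
      * ((1 + (Fintype.card n : ℝ) + (64 : ℝ) ^ (2 * d + 1) * (d : ℝ) ^ 4 * (Fintype.card n : ℝ) ^ 2 * (N : ℝ) ^ (d + 2)) * b₀) ≤ 1 / 25)
    (hreg₃ : r₀ + 5 / 2 * ((16 * (d : ℝ) ^ 2) * (L : ℝ) ^ (j + 1)
      * ((1 + (Fintype.card n : ℝ) + (64 : ℝ) ^ (2 * d + 1) * (d : ℝ) ^ 4 * (Fintype.card n : ℝ) ^ 2 * (N : ℝ) ^ (d + 2)) * b₀)) ≤ 1 / 20)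
    (hline : (1 + (Fintype.card n : ℝ) + (64 : ℝ) ^ (2 * d + 1) * (d : ℝ) ^ 4 * (Fintype.card n : ℝ) ^ 2 * (N : ℝ) ^ (d + 2))
      * (4 * ((16 * (d : ℝ) ^ 3) * ((L : ℝ) ^ (j + 1)) ^ 2)
          * (b₀ + 4 * ((1 + (Fintype.card n : ℝ) + (64 : ℝ) ^ (2 * d + 1) * (d : ℝ) ^ 4 * (Fintype.card n : ℝ) ^ 2 * (N : ℝ) ^ (d + 2)) * b₀))
        + 25 * d * (r₀ + 5 / 2 * ((16 * (d : ℝ) ^ 2) * (L : ℝ) ^ (j + 1)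
            * ((1 + (Fintype.card n : ℝ) + (64 : ℝ) ^ (2 * d + 1) * (d : ℝ) ^ 4 * (Fintype.card n : ℝ) ^ 2 * (N : ℝ) ^ (d + 2)) * b₀)))
            * ((16 * (d : ℝ) ^ 2) * (L : ℝ) ^ (j + 1))
        + 14 * d * ((16 * (d : ℝ) ^ 2) * (L : ℝ) ^ (j + 1)) ^ 2
            * ((1 + (Fintype.card n : ℝ) + (64 : ℝ) ^ (2 * d + 1) * (d : ℝ) ^ 4 * (Fintype.card n : ℝ) ^ 2 * (N : ℝ) ^ (d + 2)) * b₀)) ≤ 1 / 2) :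
    ∃ (u : Site d → (Matrix n n ℂ)ˣ) (Z : Site d → Fin d → (Matrix n n ℂ)),
      IsUnitarySite u ∧ IsPeriodicSite u ((N * L ^ (j + 1) : ℕ) : ℤ) ∧ IsSkewDir Z ∧ IsPeriodicDir Z ((N * L ^ (j + 1) : ℕ) : ℤ) ∧
      gaugeAct u U = vary (flatCfg (d := d) (n := n)) Z 1 ∧ IsLandauB8 (d := d) L N (j + 1) (flatCfg (d := d) (n := n)) Z ∧
      (∀ (y : Site d) (μ : Fin d), ‖((gaugeAct u U y μ : (Matrix n n ℂ)ˣ) : (Matrix n n ℂ)) - 1‖ ≤ r₀ + 5 / 2 * ((16 * (d : ℝ) ^ 2) * (L : ℝ) ^ (j + 1)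
        * ((1 + (Fintype.card n : ℝ) + (64 : ℝ) ^ (2 * d + 1) * (d : ℝ) ^ 4 * (Fintype.card n : ℝ) ^ 2 * (N : ℝ) ^ (d + 2)) * b₀))) ∧
      (∀ (y : Site d) (μ : Fin d), ‖Z y μ‖ ≤ 2 * (r₀ + 5 / 2 * ((16 * (d : ℝ) ^ 2) * (L : ℝ) ^ (j + 1)
        * ((1 + (Fintype.card n : ℝ) + (64 : ℝ) ^ (2 * d + 1) * (d : ℝ) ^ 4 * (Fintype.card n : ℝ) ^ 2 * (N : ℝ) ^ (d + 2)) * b₀)))) ∧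
      (∀ y : Site d, ‖((u y : (Matrix n n ℂ)ˣ) : (Matrix n n ℂ)) - 1‖ ≤ 4 * ((16 * (d : ℝ) ^ 3) * ((L : ℝ) ^ (j + 1)) ^ 2
        * ((1 + (Fintype.card n : ℝ) + (64 : ℝ) ^ (2 * d + 1) * (d : ℝ) ^ 4 * (Fintype.card n : ℝ) ^ 2 * (N : ℝ) ^ (d + 2)) * b₀))) ∧
      (∀ x : Site d, ‖covDiv (flatCfg (d := d) (n := n)) Z x‖
        ≤ b₀ + 3 * ((1 + (Fintype.card n : ℝ) + (64 : ℝ) ^ (2 * d + 1) * (d : ℝ) ^ 4 * (Fintype.card n : ℝ) ^ 2 * (N : ℝ) ^ (d + 2)) * b₀)) := by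
  have hL1 : 1 ≤ L := by omega
  refine exists_flatLandauRep_of_supFacts hd hL hN j (c₀ := 16 * (d : ℝ) ^ 3) (c₁ := 16 * (d : ℝ) ^ 2)
    (cR := 1 + (Fintype.card n : ℝ) + (64 : ℝ) ^ (2 * d + 1) * (d : ℝ) ^ 4 * (Fintype.card n : ℝ) ^ 2 * (N : ℝ) ^ (d + 2))
    (by positivity) (by positivity) ?_ (fun mu hmu B hB => supRegularity_flatCfg hL1 hN j hmu hB)
    (fun F hFs hFP mu hmu horth B hFB y => covLapSite_sup_le_flatCfg hL hN j F hFs hFP hmu horth hFB y)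
    hUu hUP hr₀ hb₀ hreg₁ hreg₂ hreg₃ hline
  have : (0 : ℝ) ≤ (Fintype.card n : ℝ) + (64 : ℝ) ^ (2 * d + 1) * (d : ℝ) ^ 4 * (Fintype.card n : ℝ) ^ 2 * (N : ℝ) ^ (d + 2) := by positivity
  linarith

/-- **THE k-UNIFORM FORM AT FIXED TORUS** (every `d ≥ 1`, `L ≥ 2`, `N ≥ 1`, `n`): there is `ρ > 0` depending on `d`, `card n`, `N` ONLY — NOT on the
level `j` — such that for every `j`, `M = L^{j+1}`, and every unitary `(N·M)`-periodic `U` with `‖U(b) − 1‖ ≤ r₀`, `‖covDiv 1 (log U)‖_∞ ≤ b₀`,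
`0 ≤ r₀, b₀` and the two (−1)∕(−2)-SIZE smallness conditions `M·r₀ ≤ ρ`, `M²·b₀ ≤ ρ`, the exact (1.38)-Landau representative of `exists_flatLandauRep`
exists, with `‖U^{u}(b) − 1‖ ≤ r₀ + 40d²c_R·M·b₀`, `‖Z(b)‖ ≤ 2(r₀ + 40d²c_R·M·b₀)`, `‖u − 1‖ ≤ 64d³c_R·M²·b₀`, `c_R = 1 + card n + 64^{2d+1}d⁴(card n)²N^{d+2}`
(so `‖Z‖ = O((M r₀ + M² b₀)∕M)`: the sup member of [Balaban1985RegularSpaces] (1.36) at `U₀ = 1` in its own currency).  `ρ = 1∕S` with `S` an explicit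
polynomial in `d`, `c_R`. [folklore] -/
theorem exists_flatLandauRep_uniform [Nonempty n] (hd : 1 ≤ d) {L N : ℕ} (hL : 2 ≤ L) (hN : 1 ≤ N) :
    ∃ ρ : ℝ, 0 < ρ ∧ ∀ (j : ℕ) {U : Site d → Fin d → (Matrix n n ℂ)ˣ}, IsUnitaryCfg U → IsPeriodicCfg U ((N * L ^ (j + 1) : ℕ) : ℤ) →
      ∀ {r₀ b₀ : ℝ}, 0 ≤ r₀ → 0 ≤ b₀ → (∀ (y : Site d) (μ : Fin d), ‖((U y μ : (Matrix n n ℂ)ˣ) : (Matrix n n ℂ)) - 1‖ ≤ r₀) →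
      (∀ x : Site d, ‖covDiv (flatCfg (d := d) (n := n)) (fun y μ => mlog ((U y μ : (Matrix n n ℂ)ˣ) : (Matrix n n ℂ))) x‖ ≤ b₀) →
      (L : ℝ) ^ (j + 1) * r₀ ≤ ρ → ((L : ℝ) ^ (j + 1)) ^ 2 * b₀ ≤ ρ →
      ∃ (u : Site d → (Matrix n n ℂ)ˣ) (Z : Site d → Fin d → (Matrix n n ℂ)),
        IsUnitarySite u ∧ IsPeriodicSite u ((N * L ^ (j + 1) : ℕ) : ℤ) ∧ IsSkewDir Z ∧ IsPeriodicDir Z ((N * L ^ (j + 1) : ℕ) : ℤ) ∧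
        gaugeAct u U = vary (flatCfg (d := d) (n := n)) Z 1 ∧ IsLandauB8 (d := d) L N (j + 1) (flatCfg (d := d) (n := n)) Z ∧
        (∀ (y : Site d) (μ : Fin d), ‖((gaugeAct u U y μ : (Matrix n n ℂ)ˣ) : (Matrix n n ℂ)) - 1‖ ≤ r₀ + 40 * (d : ℝ) ^ 2
          * (1 + (Fintype.card n : ℝ) + (64 : ℝ) ^ (2 * d + 1) * (d : ℝ) ^ 4 * (Fintype.card n : ℝ) ^ 2 * (N : ℝ) ^ (d + 2))
          * (L : ℝ) ^ (j + 1) * b₀) ∧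
        (∀ (y : Site d) (μ : Fin d), ‖Z y μ‖ ≤ 2 * (r₀ + 40 * (d : ℝ) ^ 2
          * (1 + (Fintype.card n : ℝ) + (64 : ℝ) ^ (2 * d + 1) * (d : ℝ) ^ 4 * (Fintype.card n : ℝ) ^ 2 * (N : ℝ) ^ (d + 2))
          * (L : ℝ) ^ (j + 1) * b₀)) ∧
        (∀ y : Site d, ‖((u y : (Matrix n n ℂ)ˣ) : (Matrix n n ℂ)) - 1‖ ≤ 64 * (d : ℝ) ^ 3
          * (1 + (Fintype.card n : ℝ) + (64 : ℝ) ^ (2 * d + 1) * (d : ℝ) ^ 4 * (Fintype.card n : ℝ) ^ 2 * (N : ℝ) ^ (d + 2))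
          * ((L : ℝ) ^ (j + 1)) ^ 2 * b₀) := by
  set cR : ℝ := 1 + (Fintype.card n : ℝ) + (64 : ℝ) ^ (2 * d + 1) * (d : ℝ) ^ 4 * (Fintype.card n : ℝ) ^ 2 * (N : ℝ) ^ (d + 2) with hcR
  set c₀ : ℝ := 16 * (d : ℝ) ^ 3 with hc₀
  set c₁ : ℝ := 16 * (d : ℝ) ^ 2 with hc₁
  have hcR1 : 1 ≤ cR := by
    have : (0 : ℝ) ≤ (Fintype.card n : ℝ) + (64 : ℝ) ^ (2 * d + 1) * (d : ℝ) ^ 4 * (Fintype.card n : ℝ) ^ 2 * (N : ℝ) ^ (d + 2) := by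
      positivity
    rw [hcR]; linarith
  have hc₀0 : 0 ≤ c₀ := by positivity
  have hc₁0 : 0 ≤ c₁ := by positivity
  have hcR0 : 0 ≤ cR := by linarith
  have hd0 : (0 : ℝ) ≤ d := Nat.cast_nonneg d
  -- one denominator dominating the four lines
  set S : ℝ := 10 * (c₀ * cR) + 25 * (c₁ * cR) + 20 * (1 + 5 / 2 * (c₁ * cR))
    + 2 * (cR * (4 * c₀ * (1 + 4 * cR) + 25 * d * c₁ * (1 + 5 / 2 * (c₁ * cR)) + 14 * d * c₁ ^ 2 * cR)) with hS
  have hS20 : 20 ≤ S := by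
    have h1 : 0 ≤ 10 * (c₀ * cR) + 25 * (c₁ * cR) := by positivity
    have h2 : 0 ≤ 20 * (5 / 2 * (c₁ * cR)) := by positivity
    have h3 : 0 ≤ 2 * (cR * (4 * c₀ * (1 + 4 * cR) + 25 * d * c₁ * (1 + 5 / 2 * (c₁ * cR)) + 14 * d * c₁ ^ 2 * cR)) := by positivity
    rw [hS]; linarith
  have hS0 : 0 < S := by linarith
  refine ⟨1 / S, by positivity, ?_⟩
  intro j U hUu hUP r₀ b₀ hr₀0 hb₀0 hr₀ hb₀ hs ht
  set M : ℝ := (L : ℝ) ^ (j + 1) with hM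
  have hM1 : 1 ≤ M := one_le_pow₀ (by exact_mod_cast (by omega : 1 ≤ L))
  have hM0 : 0 ≤ M := by linarith
  -- the two currencies `s = M·r₀`, `t = M²·b₀`
  have htn : 0 ≤ M ^ 2 * b₀ := by positivity
  have hMb : M * b₀ ≤ M ^ 2 * b₀ := by
    have : M * b₀ ≤ M * (M * b₀) := le_mul_of_one_le_left (by positivity) hM1
    linarith [this, show M * (M * b₀) = M ^ 2 * b₀ by ring]
  have hrs : r₀ ≤ M * r₀ := le_mul_of_one_le_left hr₀0 hM1
  have hρS : ∀ {c X : ℝ}, 0 < c → c * X ≤ S → X * (1 / S) ≤ 1 / c := fun {c X} hc hX => by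
    rw [mul_one_div, div_le_div_iff₀ hS0 hc]; linarith
  -- nonnegativity of the blocks of `S`
  have hA : 0 ≤ c₀ * cR := by positivity
  have hB : 0 ≤ c₁ * cR := by positivity
  have hC : 0 ≤ cR * (4 * c₀ * (1 + 4 * cR) + 25 * d * c₁ * (1 + 5 / 2 * (c₁ * cR)) + 14 * d * c₁ ^ 2 * cR) := by positivity
  have hS1 : 10 * (c₀ * cR) ≤ S := by rw [hS]; linarith
  have hS2 : 25 * (c₁ * cR) ≤ S := by rw [hS]; linarith
  have hS3 : 20 * (1 + 5 / 2 * (c₁ * cR)) ≤ S := by rw [hS]; linarith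
  have hS4 : 2 * (cR * (4 * c₀ * (1 + 4 * cR) + 25 * d * c₁ * (1 + 5 / 2 * (c₁ * cR)) + 14 * d * c₁ ^ 2 * cR)) ≤ S := by
    rw [hS]; linarith
  -- line (1)
  have h1 : c₀ * M ^ 2 * (cR * b₀) ≤ 1 / 10 := by
    have e : c₀ * M ^ 2 * (cR * b₀) = (c₀ * cR) * (M ^ 2 * b₀) := by ring
    rw [e]
    exact (mul_le_mul_of_nonneg_left ht hA).trans (hρS (by norm_num) hS1)
  -- line (2)
  have h2 : c₁ * M * (cR * b₀) ≤ 1 / 25 := by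
    have e : c₁ * M * (cR * b₀) = (c₁ * cR) * (M * b₀) := by ring
    rw [e]
    exact (mul_le_mul_of_nonneg_left (hMb.trans ht) hB).trans (hρS (by norm_num) hS2)
  -- line (3)
  have h3 : r₀ + 5 / 2 * (c₁ * M * (cR * b₀)) ≤ 1 / 20 := by
    have e : 5 / 2 * (c₁ * M * (cR * b₀)) = 5 / 2 * (c₁ * cR) * (M * b₀) := by ring
    rw [e]
    have i1 : r₀ ≤ 1 / S := hrs.trans hs
    have i2 : 5 / 2 * (c₁ * cR) * (M * b₀) ≤ 5 / 2 * (c₁ * cR) * (1 / S) := mul_le_mul_of_nonneg_left (hMb.trans ht) (by positivity)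
    have i3 : (1 + 5 / 2 * (c₁ * cR)) * (1 / S) ≤ 1 / 20 := hρS (by norm_num) hS3
    linarith [i1, i2, i3, show (1 + 5 / 2 * (c₁ * cR)) * (1 / S) = 1 / S + 5 / 2 * (c₁ * cR) * (1 / S) by ring]
  -- line (4)
  have h4 : cR * (4 * (c₀ * M ^ 2) * (b₀ + 4 * (cR * b₀)) + 25 * d * (r₀ + 5 / 2 * (c₁ * M * (cR * b₀))) * (c₁ * M)
      + 14 * d * (c₁ * M) ^ 2 * (cR * b₀)) ≤ 1 / 2 := by
    have e : cR * (4 * (c₀ * M ^ 2) * (b₀ + 4 * (cR * b₀)) + 25 * d * (r₀ + 5 / 2 * (c₁ * M * (cR * b₀))) * (c₁ * M)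
        + 14 * d * (c₁ * M) ^ 2 * (cR * b₀))
        = (cR * (4 * c₀ * (1 + 4 * cR) + 25 * d * c₁ * (5 / 2 * (c₁ * cR)) + 14 * d * c₁ ^ 2 * cR)) * (M ^ 2 * b₀)
          + (cR * (25 * d * c₁)) * (M * r₀) := by ring
    rw [e]
    have k1 : 0 ≤ cR * (4 * c₀ * (1 + 4 * cR) + 25 * d * c₁ * (5 / 2 * (c₁ * cR)) + 14 * d * c₁ ^ 2 * cR) := by positivity
    have k2 : 0 ≤ cR * (25 * d * c₁) := by positivity
    have i1 := mul_le_mul_of_nonneg_left ht k1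
    have i2 := mul_le_mul_of_nonneg_left hs k2
    have i3 : (cR * (4 * c₀ * (1 + 4 * cR) + 25 * d * c₁ * (1 + 5 / 2 * (c₁ * cR)) + 14 * d * c₁ ^ 2 * cR)) * (1 / S) ≤ 1 / 2 :=
      hρS (by norm_num) hS4
    have e2 : (cR * (4 * c₀ * (1 + 4 * cR) + 25 * d * c₁ * (1 + 5 / 2 * (c₁ * cR)) + 14 * d * c₁ ^ 2 * cR)) * (1 / S)
        = (cR * (4 * c₀ * (1 + 4 * cR) + 25 * d * c₁ * (5 / 2 * (c₁ * cR)) + 14 * d * c₁ ^ 2 * cR)) * (1 / S)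
          + (cR * (25 * d * c₁)) * (1 / S) := by ring
    linarith [i1, i2, i3, e2]
  obtain ⟨u, Z, huU, huP, hZs, hZP, hrep, hLan, hr, hZ, hu1, -⟩ := exists_flatLandauRep hd hL hN j hUu hUP hr₀ hb₀ h1 h2 h3 h4
  refine ⟨u, Z, huU, huP, hZs, hZP, hrep, hLan, fun y μ => (hr y μ).trans (le_of_eq ?_), fun y μ => (hZ y μ).trans (le_of_eq ?_),
    fun y => (hu1 y).trans (le_of_eq ?_)⟩
  · simp only [hcR, hM]; ring
  · simp only [hcR, hM]; ring
  · simp only [hcR, hM]; ring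

end

end Summit.QuantumFields.BalabanUV.T4Continuum.NE3.FlatLandauRep
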